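import Summits.BirchSwinnertonDyer.BirchSwinnertonDyer.Theorems.EisensteinPrimesMazurMCOnX1RankZeroInterludeDefs
import Summits.BirchSwinnertonDyer.BirchSwinnertonDyer.Theorems.EisensteinPrimesMazurMCOnX1RankZeroInterludeRoadBResidueP
import HarnessLib

/-!
# Crux `MazurMCOnX1RankZero` (item stmt-BirchSwinnertonDyer-19035), line `interlude_with_torsion` (skeleton v8, sha `faab8ba9…`):
# the registered stub `stub_roadBResidueP : RoadBResidueP` — road B (B1c) at degree exactly `p` — CLOSED BY NAME

Cell `bsd-eis` (host `run/shared/lean/pub/bsd-eis/`), LEAD `cruxlead-19035` (g0). The registered stub of the skeleton of record v8,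
with its signature VERBATIM over the tree currency `RoadBResidueP := ResidualGL1FinitenessOdd → KerSelmerMapFiniteOfDegreeP` of
`Theorems/…InterludeDefs.lean` (p685554), folded by definitional unfolding from the tree theorem
`kerSelmerMapFiniteOfDegreeP_of_residualGL1FinitenessOdd` of `Theorems/…InterludeRoadBResidueP.lean` (p687054 + p686588; mathematics
by the ideator bsd-idea-11 g16 — companion workfile `Lines/interlude_stepsTwoThree_split_idea11g6_roadB_helpers.lean` §Core
`roadB_residue_p_core`, memo §10 (R1)–(R6) — moved into the tree by this lead's stub-worker W1). HONEST FRAMING: this is an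
IMPLICATION — finiteness of the Selmer kernel along one degree-`p` `ℚ`-isogeny over the cyclotomic tower of `K` GIVEN the residual
`GL(1)` finiteness (B3) (`ResidualGL1FinitenessOdd`, registered stub `stub_residualGL1FinitenessOdd`, OPEN, print-assembly:
Ferrero–Washington + Brumer–Leopoldt + Iwasawa); nothing about any curve, BSD, Mazur's main conjecture or IMC2 is proved.
[cite: GreenbergLNM1716, §5, proof of Prop. 5.10] [cite: SilvermanAEC2009, Thm. VII.4.1, Thm. III.6.2]
-/

set_option linter.dupNamespace false
set_option autoImplicit false

noncomputable section

namespace Summit.BirchSwinnertonDyer.BirchSwinnertonDyer.Theorems.InterludeWithTorsion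

/-- **`stub_roadBResidueP` — road B (B1c) at degree exactly `p`, BY NAME** (registered stub of crux 5's skeleton v8; type
`RoadBResidueP := ResidualGL1FinitenessOdd → KerSelmerMapFiniteOfDegreeP`, tree currencies): along ONE `ℚ`-isogeny `ψ₀ : W → W'` of
degree `p` between elliptic curves over `ℚ`, for an imaginary quadratic `K` with `p = v v̄` odd and the cyclotomic `κ`, the Selmer map
`Sel_v̄(K_∞, ψ₀/K)` (`K2e.acSelmerMap`) has FINITE kernel, GIVEN the residual `GL(1)` finiteness (B3) — the tree theorem
`kerSelmerMapFiniteOfDegreeP_of_residualGL1FinitenessOdd` ((R1) cocycle lift to `H¹(K_∞, E[ψ₀])`, (R2) one place above `v̄`,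
(R3) finite local discrepancy without Imai, (R4) forward Néron–Ogg–Shafarevich, (R5)/(R6) assembly), by definitional unfolding.
[cite: GreenbergLNM1716, §5, proof of Prop. 5.10] [cite: GreenbergVatsal2000, §2 (Prop. 2.8 and its proof)] -/
theorem stub_roadBResidueP : RoadBResidueP :=
  kerSelmerMapFiniteOfDegreeP_of_residualGL1FinitenessOdd

end Summit.BirchSwinnertonDyer.BirchSwinnertonDyer.Theorems.InterludeWithTorsion

end
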